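import Summits.Langlands.Langlands.Theorems.PhantomRMYoshidaResiduallyYoshidaLiftingGreenbergSelmerDefs
import Summits.Langlands.Langlands.Theorems.PhantomRMYoshidaResiduallyYoshidaLiftingAdjugateDualCocycle
import HarnessLib

/-!
# Route `PhantomRMYoshida`, crux `ResiduallyYoshidaLifting` (stmt-Langlands-13639), line `sector-klingen-split`:
# stubs D4 `stub_adjugateDualGreenbergSelmer` and D6 `stub_rankLeOne_symm` — the Greenberg–Selmer condition is
# self-dual under the adjugate duality, and rank one is orientation-independent

Stub-worker of lead prover-line-stmt-Langlands-13639-c5-0 (skeleton rev 15, sub-goals D4 and D6).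

**D4 (`stub_adjugateDualGreenbergSelmer`).**  For a pair `σ̄, σ̄' : Γ_ℚ → GL₂(k)` with a common determinant the adjugate
duality `B ↦ B'(g) = -(det σ̄ g)⁻¹ • σ̄'(g) · adj(B g) · σ̄(g)` of D2 (`Fibre.stub_adjugateDualCocycle`) carries
Greenberg–Selmer cocycles for `(σ̄, σ̄')` with ramification inside `S` to Greenberg–Selmer cocycles for `(σ̄', σ̄)`, and `B`
is a coboundary iff `B'` is.  Proof: the cocycle identity and the coboundary equivalence are D2 (`dual_forward`,
`stub_adjugateDualCocycle`); `B'` is locally constant because `B` is and `σ̄, σ̄'` are continuous into the DISCRETE group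
`GL₂(k)`; `B i = 0 ⇒ B' i = 0` (`adj 0 = 0`); and the decomposition-group Greenberg condition transports with the
lines EXCHANGED (`x₁ ↔ y₁`) and the correction `X₀ ↦ -adj X₀` (`dualCore_coboundary`: the dual of the corrected cochain
`B̃ = B - δX₀` is `B̃' = B' - δ'(-adj X₀)`).  The three non-trivial clauses all follow from ONE identity for the skew
pairing `⟨x, u⟩ = x₀ u₁ - x₁ u₀ = det [x | u]` on `k²`, namely `⟨y, adj(T) x⟩ = -⟨x, T y⟩`
(`skew_adjugate_mulVec`), together with `⟨x, u⟩ = 0 ⇔ u ∈ k x` for `x ≠ 0`: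
`T y₁ ∈ k x₁ ⇒ adj(T) x₁ ∈ k y₁`; `T(k²) ⊆ k x₁ ⇒ adj(T) x₁ = 0`; `T y₁ = 0 ⇒ adj(T)(k²) ⊆ k y₁`.

**D6 (`stub_rankLeOne_symm`).**  `GreenbergSelmerRankLeOne` is symmetric in the pair: given rank one for `(σ̄, σ̄')`
and two non-trivial Selmer cocycles `B₁, B₂` for `(σ̄', σ̄)`, their mirror duals `D' Bᵢ` are non-trivial Selmer cocycles
for `(σ̄, σ̄')` (D4 for the mirror pair), so `D' B₂ = c • D' B₁ + δX`; applying the (linear) duality `D` and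
`D (D' B) = B` (D2) returns `B₂ = c • B₁ + δ'(-adj X)`.  Both directions are this argument with the roles exchanged.

No new definitions; Mathlib only beyond the `GreenbergSelmerDefs` currency (p170860) and D2 (p164728); no named facts.
-/

noncomputable section

-- `Summit.Langlands.Langlands.…` (summit = sub-problem name, D-0017 layout) trips `dupNamespace` on every decl.
set_option linter.dupNamespace false
set_option autoImplicit false

open IsDedekindDomain Filter
open scoped Matrix
open Literature.NumberTheory.GaloisRepresentations Literature.NumberTheory.Automorphic

namespace Summit.Langlands.Langlands.Cruxes.ResiduallyYoshidaLifting.SectorKlingenSplit.Fibre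

section TwoByTwo

variable {k : Type*} [Field k]

/-! ## The skew pairing `⟨x, u⟩ = x₀ u₁ - x₁ u₀` on `k²` and the adjugate -/

/-- For `x ≠ 0` in `k²`, `⟨x, u⟩ = x₀ u₁ - x₁ u₀ = 0` forces `u ∈ k x`. [folklore] -/
theorem exists_eq_smul_of_skew_eq_zero {x u : Fin 2 → k} (hx : x ≠ 0) (h : x 0 * u 1 - x 1 * u 0 = 0) :
    ∃ e : k, u = e • x := by
  by_cases h0 : x 0 = 0
  · have h1 : x 1 ≠ 0 := fun h1 => hx (by ext i; fin_cases i <;> simp [h0, h1])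
    rw [h0, zero_mul, zero_sub, neg_eq_zero, mul_eq_zero] at h
    refine ⟨u 1 / x 1, ?_⟩
    ext i
    fin_cases i
    · simp [h0, h.resolve_left h1]
    · simp [div_mul_cancel₀ _ h1]
  · refine ⟨u 0 / x 0, ?_⟩
    ext i
    fin_cases i
    · simp [div_mul_cancel₀ _ h0]
    · simp only [Fin.mk_one, Pi.smul_apply, smul_eq_mul]
      field_simp
      linear_combination h

/-- `⟨x, e • x⟩ = 0`. [folklore] -/
theorem skew_smul_self (x : Fin 2 → k) (e : k) : x 0 * (e • x) 1 - x 1 * (e • x) 0 = 0 := by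
  simp only [Pi.smul_apply, smul_eq_mul]
  ring

/-- A vector pairing to zero with every vector is zero. [folklore] -/
theorem eq_zero_of_forall_skew_eq_zero {u : Fin 2 → k} (h : ∀ z : Fin 2 → k, z 0 * u 1 - z 1 * u 0 = 0) :
    u = 0 := by
  have h0 := h (Pi.single 0 1)
  have h1 := h (Pi.single 1 1)
  simp only [Pi.single_eq_same, ne_eq, one_ne_zero, not_false_eq_true, Pi.single_eq_of_ne, zero_ne_one,
    one_mul, zero_mul, sub_zero, zero_sub, neg_eq_zero] at h0 h1
  ext i
  fin_cases i
  · exact h1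
  · exact h0

/-- **The one identity behind the duality of the Greenberg condition**: for `T ∈ M₂(k)` and `x, y ∈ k²`,
`⟨y, adj(T) x⟩ = -⟨x, T y⟩` (both are `∓ yᵀ J adj(T) x` with `adj T = J⁻¹ Tᵀ J`). [folklore] -/
theorem skew_adjugate_mulVec (T : Matrix (Fin 2) (Fin 2) k) (x y : Fin 2 → k) :
    y 0 * (T.adjugate *ᵥ x) 1 - y 1 * (T.adjugate *ᵥ x) 0 = -(x 0 * (T *ᵥ y) 1 - x 1 * (T *ᵥ y) 0) := by
  rw [Matrix.adjugate_fin_two]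
  simp only [Matrix.mulVec, dotProduct, Matrix.of_apply, Matrix.cons_val', Matrix.cons_val_fin_one,
    Matrix.cons_val_one, Fin.sum_univ_two, Matrix.cons_val_zero]
  ring

/-- Parallelism transfer: `T y ∈ k x ⇒ adj(T) x ∈ k y` (for `y ≠ 0`). [folklore] -/
theorem exists_adjugate_mulVec_eq_smul {T : Matrix (Fin 2) (Fin 2) k} {x y : Fin 2 → k} (hy : y ≠ 0)
    (h : ∃ c : k, T *ᵥ y = c • x) : ∃ e : k, T.adjugate *ᵥ x = e • y := by
  obtain ⟨c, hc⟩ := h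
  refine exists_eq_smul_of_skew_eq_zero hy ?_
  rw [skew_adjugate_mulVec, hc, skew_smul_self, neg_zero]

/-- `T(k²) ⊆ k x ⇒ adj(T) x = 0`. [folklore] -/
theorem adjugate_mulVec_eq_zero_of_range {T : Matrix (Fin 2) (Fin 2) k} {x : Fin 2 → k}
    (h : ∀ z : Fin 2 → k, ∃ c : k, T *ᵥ z = c • x) : T.adjugate *ᵥ x = 0 := by
  refine eq_zero_of_forall_skew_eq_zero fun z => ?_
  obtain ⟨c, hc⟩ := h z
  rw [skew_adjugate_mulVec, hc, skew_smul_self, neg_zero]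

/-- `T y = 0 ⇒ adj(T)(k²) ⊆ k y` (for `y ≠ 0`). [folklore] -/
theorem exists_adjugate_mulVec_eq_smul_of_mulVec_eq_zero {T : Matrix (Fin 2) (Fin 2) k} {y : Fin 2 → k}
    (hy : y ≠ 0) (h : T *ᵥ y = 0) (z : Fin 2 → k) : ∃ e : k, T.adjugate *ᵥ z = e • y := by
  refine exists_eq_smul_of_skew_eq_zero hy ?_
  rw [skew_adjugate_mulVec, h, Pi.zero_apply, Pi.zero_apply, mul_zero, mul_zero, sub_zero, neg_zero]

/-! ## The three non-trivial clauses of the dual Greenberg condition, one matrix at a time -/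

/-- Clause (d'): if `S x ∈ k x`, `S' y ∈ k y` and `T y ∈ k x` then `(e • S' adj(T) S) x ∈ k y`. [folklore] -/
theorem exists_dual_mulVec_eq_smul {S S' T : Matrix (Fin 2) (Fin 2) k} {x y : Fin 2 → k} (e : k) (hy : y ≠ 0)
    (ha : ∃ a : k, S *ᵥ x = a • x) (hb : ∃ b : k, S' *ᵥ y = b • y) (hc : ∃ c : k, T *ᵥ y = c • x) :
    ∃ c : k, (e • (S' * T.adjugate * S)) *ᵥ x = c • y := by
  obtain ⟨a, ha⟩ := ha
  obtain ⟨b, hb⟩ := hb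
  obtain ⟨f, hf⟩ := exists_adjugate_mulVec_eq_smul hy hc
  refine ⟨e * a * f * b, ?_⟩
  rw [Matrix.smul_mulVec, ← Matrix.mulVec_mulVec, ← Matrix.mulVec_mulVec, ha, Matrix.mulVec_smul, hf,
    Matrix.mulVec_smul, Matrix.mulVec_smul, hb, smul_smul, smul_smul, smul_smul]

/-- Clause (g'): if `S x = x` and `T(k²) ⊆ k x` then `(e • S' adj(T) S) x = 0`. [folklore] -/
theorem dual_mulVec_eq_zero {S S' T : Matrix (Fin 2) (Fin 2) k} {x : Fin 2 → k} (e : k) (ha : S *ᵥ x = x)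
    (hd : ∀ z : Fin 2 → k, ∃ c : k, T *ᵥ z = c • x) : (e • (S' * T.adjugate * S)) *ᵥ x = 0 := by
  rw [Matrix.smul_mulVec, ← Matrix.mulVec_mulVec, ← Matrix.mulVec_mulVec, ha,
    adjugate_mulVec_eq_zero_of_range hd, Matrix.mulVec_zero, smul_zero]

/-- Clause (h'): if `S' y ∈ k y` and `T y = 0` then `(e • S' adj(T) S)(k²) ⊆ k y`. [folklore] -/
theorem exists_dual_mulVec_eq_smul_of_mulVec_eq_zero {S S' T : Matrix (Fin 2) (Fin 2) k} {y : Fin 2 → k}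
    (e : k) (hy : y ≠ 0) (hb : ∃ b : k, S' *ᵥ y = b • y) (hc : T *ᵥ y = 0) (z : Fin 2 → k) :
    ∃ c : k, (e • (S' * T.adjugate * S)) *ᵥ z = c • y := by
  obtain ⟨b, hb⟩ := hb
  obtain ⟨f, hf⟩ := exists_adjugate_mulVec_eq_smul_of_mulVec_eq_zero hy hc (S *ᵥ z)
  refine ⟨e * f * b, ?_⟩
  rw [Matrix.smul_mulVec, ← Matrix.mulVec_mulVec, ← Matrix.mulVec_mulVec, hf, Matrix.mulVec_smul, hb, smul_smul,
    smul_smul]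

/-- The dual of the CORRECTED cochain: `B' - δ'(-adj X₀) = (B - δX₀)'` for `S, S'` of common unit determinant `u`
(`dualCore_coboundary` and the additivity of `adj` on `M₂`). [folklore] -/
theorem dual_sub_coboundary (S S' B X₀ : Matrix (Fin 2) (Fin 2) k) (u : kˣ) (hS : S.det = u) (hS' : S'.det = u) :
    -((u⁻¹ : kˣ) : k) • (S' * B.adjugate * S) - (S' * (-X₀.adjugate) - (-X₀.adjugate) * S) =
      -((u⁻¹ : kˣ) : k) • (S' * (B - (S * X₀ - X₀ * S')).adjugate * S) := by
  rw [adjugate_two_sub B, Matrix.mul_sub, Matrix.sub_mul, smul_sub, dualCore_coboundary S S' X₀ u hS hS']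

/-- **The decomposition-group Greenberg condition is self-dual** (core of D4, over an arbitrary index type `ι` with an
inertia predicate `I`): for `S, S' : ι → M₂(k)` of common unit determinant `u` and a cochain `B` satisfying the nine
clauses of `IsGreenbergDecAt` with data `(X₀, x₁, y₁)`, the dual cochain `B' i = -(u i)⁻¹ • (S' i · adj(B i) · S i)`
satisfies them for the exchanged pair `(S', S)` with data `(-adj X₀, y₁, x₁)`. [folklore] -/
theorem greenbergDec_dual {ι : Type*} (I : ι → Prop) (S S' B : ι → Matrix (Fin 2) (Fin 2) k) (u : ι → kˣ)
    (hS : ∀ i, (S i).det = u i) (hS' : ∀ i, (S' i).det = u i)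
    (h : ∃ (X₀ : Matrix (Fin 2) (Fin 2) k) (x₁ y₁ : Fin 2 → k), x₁ ≠ 0 ∧ y₁ ≠ 0 ∧
      (∀ i, ∃ a : k, S i *ᵥ x₁ = a • x₁) ∧ (∀ i, ∃ b : k, S' i *ᵥ y₁ = b • y₁) ∧
      (∀ i, ∃ c : k, (B i - (S i * X₀ - X₀ * S' i)) *ᵥ y₁ = c • x₁) ∧
      (∀ i, I i → S i *ᵥ x₁ = x₁) ∧ (∀ i, I i → S' i *ᵥ y₁ = y₁) ∧
      (∀ i, I i → (B i - (S i * X₀ - X₀ * S' i)) *ᵥ y₁ = 0) ∧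
      ∀ i, I i → ∀ y : Fin 2 → k, ∃ c : k, (B i - (S i * X₀ - X₀ * S' i)) *ᵥ y = c • x₁) :
    ∃ (X₀ : Matrix (Fin 2) (Fin 2) k) (x₁ y₁ : Fin 2 → k), x₁ ≠ 0 ∧ y₁ ≠ 0 ∧
      (∀ i, ∃ a : k, S' i *ᵥ x₁ = a • x₁) ∧ (∀ i, ∃ b : k, S i *ᵥ y₁ = b • y₁) ∧
      (∀ i, ∃ c : k, (-(((u i)⁻¹ : kˣ) : k) • (S' i * (B i).adjugate * S i) -
        (S' i * X₀ - X₀ * S i)) *ᵥ y₁ = c • x₁) ∧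
      (∀ i, I i → S' i *ᵥ x₁ = x₁) ∧ (∀ i, I i → S i *ᵥ y₁ = y₁) ∧
      (∀ i, I i → (-(((u i)⁻¹ : kˣ) : k) • (S' i * (B i).adjugate * S i) - (S' i * X₀ - X₀ * S i)) *ᵥ y₁ = 0) ∧
      ∀ i, I i → ∀ y : Fin 2 → k, ∃ c : k,
        (-(((u i)⁻¹ : kˣ) : k) • (S' i * (B i).adjugate * S i) - (S' i * X₀ - X₀ * S i)) *ᵥ y = c • x₁ := by
  obtain ⟨X₀, x₁, y₁, hx, hy, ha, hb, hc, hIa, hIb, hIc, hId⟩ := h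
  refine ⟨-X₀.adjugate, y₁, x₁, hy, hx, hb, ha, fun i => ?_, hIb, hIa, fun i hi => ?_, fun i hi y => ?_⟩
  · rw [dual_sub_coboundary _ _ _ _ (u i) (hS i) (hS' i)]
    exact exists_dual_mulVec_eq_smul _ hy (ha i) (hb i) (hc i)
  · rw [dual_sub_coboundary _ _ _ _ (u i) (hS i) (hS' i)]
    exact dual_mulVec_eq_zero _ (hIa i hi) (hId i hi)
  · rw [dual_sub_coboundary _ _ _ _ (u i) (hS i) (hS' i)]
    exact exists_dual_mulVec_eq_smul_of_mulVec_eq_zero _ hy (hb i) (hIc i hi) y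

end TwoByTwo

/-! ## The duality on Greenberg–Selmer cocycles of a residual pair -/

/-- **D4, general form**: for `σ̄, σ̄' : Γ_ℚ → GL₂(k)` of common determinant `d` and `D` the adjugate duality
`D B g = -d(g)⁻¹ • (σ̄'(g) · adj(B g) · σ̄(g))`, `D` carries Greenberg–Selmer cocycles for `(σ̄, σ̄')` with ramification
inside `S` to Greenberg–Selmer cocycles for `(σ̄', σ̄)` (cocycle: D2; locally constant: `GL₂(k)` is discrete; same
vanishing on inertia; Greenberg condition: `greenbergDec_dual`). [folklore] -/
theorem isGreenbergSelmerCocycle_dual (p : ℕ) [Fact p.Prime] (k : Type) [Field k] [TopologicalSpace k]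
    [DiscreteTopology k] (σ σ' : FramedGaloisRep ℚ k 2) (S : Set (HeightOneSpectrum (NumberField.RingOfIntegers ℚ)))
    (d : Field.absoluteGaloisGroup ℚ → kˣ) (hσ : ∀ g, (σ g).val.det = d g) (hσ' : ∀ g, (σ' g).val.det = d g)
    (D : (Field.absoluteGaloisGroup ℚ → Matrix (Fin 2) (Fin 2) k) →
      Field.absoluteGaloisGroup ℚ → Matrix (Fin 2) (Fin 2) k)
    (hD : ∀ B g, D B g = -(((d g)⁻¹ : kˣ) : k) • ((σ' g).val * (B g).adjugate * (σ g).val))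
    (B : Field.absoluteGaloisGroup ℚ → Matrix (Fin 2) (Fin 2) k) (hB : IsGreenbergSelmerCocycle p k σ σ' S B) :
    IsGreenbergSelmerCocycle p k σ' σ S (D B) := by
  obtain ⟨hcoc, hlc, hram, hdec⟩ := hB
  have hDB : D B = fun g => -(((d g)⁻¹ : kˣ) : k) • ((σ' g).val * (B g).adjugate * (σ g).val) := funext (hD B)
  refine ⟨?_, ?_, fun v hv 𝔓 h𝔓 i hi => ?_, fun v hv => ?_⟩
  · -- the cocycle identity (D2)
    have h := (dual_forward k (Field.absoluteGaloisGroup ℚ) σ.toMonoidHom σ'.toMonoidHom d hσ hσ' D hD).2.1 B hcoc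
    simp only [ContinuousMonoidHom.coe_toMonoidHom, MonoidHom.coe_coe] at h
    exact h
  · -- locally constant: `B` is, and `σ̄`, `σ̄'` are continuous into the discrete `GL₂(k)`
    have hσl : IsLocallyConstant (fun g => σ g) := (IsLocallyConstant.iff_continuous _).2 (map_continuous σ)
    have hσ'l : IsLocallyConstant (fun g => σ' g) := (IsLocallyConstant.iff_continuous _).2 (map_continuous σ')
    have e : D B = fun g => -((σ g).val.det)⁻¹ • ((σ' g).val * (B g).adjugate * (σ g).val) := by
      rw [hDB]
      funext g
      rw [Units.val_inv_eq_inv_val, hσ g]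
    rw [e]
    exact hσl.comp₂ (hσ'l.prodMk hlc) fun s t => -(s.val.det)⁻¹ • (t.1.val * t.2.adjugate * s.val)
  · -- vanishing on the inertia groups above `v ∉ S`
    rw [hD, hram v hv 𝔓 h𝔓 i hi, Matrix.adjugate_zero, Matrix.mul_zero, Matrix.zero_mul, smul_zero]
  · -- the decomposition-group Greenberg condition at `v ∣ p`
    rw [hDB]
    exact greenbergDec_dual (fun τ => τ ∈ absInertia (v.adicCompletion ℚ))
      (fun τ => (σ (absGaloisRestrict ℚ (v.adicCompletion ℚ) τ)).val)
      (fun τ => (σ' (absGaloisRestrict ℚ (v.adicCompletion ℚ) τ)).val)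
      (fun τ => B (absGaloisRestrict ℚ (v.adicCompletion ℚ) τ))
      (fun τ => d (absGaloisRestrict ℚ (v.adicCompletion ℚ) τ)) (fun τ => hσ _) (fun τ => hσ' _) (hdec v hv)

/-- **D4, coboundary part (general form)**: `B` is a coboundary for `(σ̄, σ̄')` iff `D B` is one for `(σ̄', σ̄)` (D2).
[folklore] -/
theorem isCoboundaryFor_dual_iff (k : Type) [Field k] [TopologicalSpace k] (σ σ' : FramedGaloisRep ℚ k 2)
    (d : Field.absoluteGaloisGroup ℚ → kˣ) (hσ : ∀ g, (σ g).val.det = d g) (hσ' : ∀ g, (σ' g).val.det = d g)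
    (D : (Field.absoluteGaloisGroup ℚ → Matrix (Fin 2) (Fin 2) k) →
      Field.absoluteGaloisGroup ℚ → Matrix (Fin 2) (Fin 2) k)
    (hD : ∀ B g, D B g = -(((d g)⁻¹ : kˣ) : k) • ((σ' g).val * (B g).adjugate * (σ g).val))
    (B : Field.absoluteGaloisGroup ℚ → Matrix (Fin 2) (Fin 2) k) :
    IsCoboundaryFor σ σ' B ↔ IsCoboundaryFor σ' σ (D B) := by
  have h := (stub_adjugateDualCocycle k (Field.absoluteGaloisGroup ℚ) σ.toMonoidHom σ'.toMonoidHom d hσ hσ' D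
    (fun A g => -(((d g)⁻¹ : kˣ) : k) • ((σ g).val * (A g).adjugate * (σ' g).val)) hD (fun _ _ => rfl)).2.2.2.2 B
  simp only [ContinuousMonoidHom.coe_toMonoidHom, MonoidHom.coe_coe] at h
  exact h

/-- **D6, one direction (general form)**: rank one for `(σ̄, σ̄')` implies rank one for `(σ̄', σ̄)` — dualise two
non-trivial Selmer cocycles of `(σ̄', σ̄)` into `(σ̄, σ̄')` (D4 for the mirror pair), compare them there, and return through
the linear involution `D ∘ D' = id` (D2), which maps coboundaries to coboundaries. [folklore] -/
theorem greenbergSelmerRankLeOne_dual (p : ℕ) [Fact p.Prime] (k : Type) [Field k] [TopologicalSpace k]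
    [DiscreteTopology k] (σ σ' : FramedGaloisRep ℚ k 2) (S : Set (HeightOneSpectrum (NumberField.RingOfIntegers ℚ)))
    (d : Field.absoluteGaloisGroup ℚ → kˣ) (hσ : ∀ g, (σ g).val.det = d g) (hσ' : ∀ g, (σ' g).val.det = d g)
    (D D' : (Field.absoluteGaloisGroup ℚ → Matrix (Fin 2) (Fin 2) k) →
      Field.absoluteGaloisGroup ℚ → Matrix (Fin 2) (Fin 2) k)
    (hD : ∀ B g, D B g = -(((d g)⁻¹ : kˣ) : k) • ((σ' g).val * (B g).adjugate * (σ g).val))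
    (hD' : ∀ B g, D' B g = -(((d g)⁻¹ : kˣ) : k) • ((σ g).val * (B g).adjugate * (σ' g).val))
    (h : GreenbergSelmerRankLeOne p k σ σ' S) : GreenbergSelmerRankLeOne p k σ' σ S := by
  intro B₁ B₂ h₁ h₂ n₁ n₂
  obtain ⟨hlin, -, hcob⟩ := dual_forward k (Field.absoluteGaloisGroup ℚ) σ.toMonoidHom σ'.toMonoidHom d hσ hσ' D hD
  have hinv : ∀ B, D (D' B) = B :=
    dual_involutive k (Field.absoluteGaloisGroup ℚ) σ'.toMonoidHom σ.toMonoidHom d hσ' hσ D' D hD' hD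
  have g₁ : IsGreenbergSelmerCocycle p k σ σ' S (D' B₁) :=
    isGreenbergSelmerCocycle_dual p k σ' σ S d hσ' hσ D' hD' B₁ h₁
  have g₂ : IsGreenbergSelmerCocycle p k σ σ' S (D' B₂) :=
    isGreenbergSelmerCocycle_dual p k σ' σ S d hσ' hσ D' hD' B₂ h₂
  have c₁ : ¬ IsCoboundaryFor σ σ' (D' B₁) := fun hc =>
    n₁ ((isCoboundaryFor_dual_iff k σ' σ d hσ' hσ D' hD' B₁).mpr hc)
  have c₂ : ¬ IsCoboundaryFor σ σ' (D' B₂) := fun hc =>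
    n₂ ((isCoboundaryFor_dual_iff k σ' σ d hσ' hσ D' hD' B₂).mpr hc)
  obtain ⟨c, X, hcX⟩ := h (D' B₁) (D' B₂) g₁ g₂ c₁ c₂
  refine ⟨c, -X.adjugate, fun g => ?_⟩
  have hE : D' B₂ = (c : k) • D' B₁ + fun g => (σ g).val * X - X * (σ' g).val := funext fun g => hcX g
  have key : B₂ = (c : k) • B₁ + D (fun g => (σ g).val * X - X * (σ' g).val) := by
    rw [← hinv B₂, hE, hlin, hinv]
  have hDX := hcob (fun g => (σ g).val * X - X * (σ' g).val) X (fun _ => rfl) g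
  simp only [ContinuousMonoidHom.coe_toMonoidHom, MonoidHom.coe_coe] at hDX
  rw [key, Pi.add_apply, Pi.smul_apply, hDX]

/-- **Registered sub-goal D4 `stub_adjugateDualGreenbergSelmer`** (crux stmt-Langlands-13639, line `sector-klingen-split`,
skeleton rev 15; duality of the Selmer CONDITION): for a pair with a common determinant the adjugate duality
`B ↦ B'(g) = -(det σ̄ g)⁻¹ • σ̄'(g) adj(B g) σ̄(g)` (D2 p164728) carries Greenberg–Selmer cocycles for `(σ̄, σ̄')` with
ramification inside `S` to Greenberg–Selmer cocycles for `(σ̄', σ̄)` (cocycle by D2; locally constant; vanishing on the same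
inertia groups; and the decomposition-group Greenberg condition transports with the lines exchanged and the correction
`X₀ ↦ -adj X₀`: `B̃ y₁ ∥ x₁ ⟺ adj(B̃) x₁ ∥ y₁`), and `B` is a coboundary iff `B'` is. [folklore] -/
theorem stub_adjugateDualGreenbergSelmer :
    ∀ (p : ℕ) [Fact p.Prime] (k : Type) [Field k] [TopologicalSpace k] [DiscreteTopology k]
      (σ σ' : FramedGaloisRep ℚ k 2) (S : Set (HeightOneSpectrum (NumberField.RingOfIntegers ℚ)))
      (B : Field.absoluteGaloisGroup ℚ → Matrix (Fin 2) (Fin 2) k),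
      (∀ g, (σ' g).val.det = (σ g).val.det) →
      (IsGreenbergSelmerCocycle p k σ σ' S B →
        IsGreenbergSelmerCocycle p k σ' σ S
          (fun g => -(((Matrix.GeneralLinearGroup.det (σ g))⁻¹ : kˣ) : k) • ((σ' g).val * (B g).adjugate * (σ g).val))) ∧
      (IsCoboundaryFor σ σ' B ↔
        IsCoboundaryFor σ' σ
          (fun g => -(((Matrix.GeneralLinearGroup.det (σ g))⁻¹ : kˣ) : k) • ((σ' g).val * (B g).adjugate * (σ g).val))) := by
  intro p _ k _ _ _ σ σ' S B hdet
  have hσ : ∀ g, (σ g).val.det = ((Matrix.GeneralLinearGroup.det (σ g) : kˣ) : k) := fun g =>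
    (Matrix.GeneralLinearGroup.val_det_apply (σ g)).symm
  have hσ' : ∀ g, (σ' g).val.det = ((Matrix.GeneralLinearGroup.det (σ g) : kˣ) : k) := fun g =>
    (hdet g).trans (hσ g)
  exact ⟨isGreenbergSelmerCocycle_dual p k σ σ' S _ hσ hσ'
      (fun A g => -(((Matrix.GeneralLinearGroup.det (σ g))⁻¹ : kˣ) : k) • ((σ' g).val * (A g).adjugate * (σ g).val))
      (fun _ _ => rfl) B,
    isCoboundaryFor_dual_iff k σ σ' _ hσ hσ'
      (fun A g => -(((Matrix.GeneralLinearGroup.det (σ g))⁻¹ : kˣ) : k) • ((σ' g).val * (A g).adjugate * (σ g).val))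
      (fun _ _ => rfl) B⟩

/-- **Registered sub-goal D6 `stub_rankLeOne_symm`** (crux stmt-Langlands-13639, line `sector-klingen-split`, skeleton
rev 15; assembly of D4 + the involutivity of D2): for a pair with a common determinant, `GreenbergSelmerRankLeOne` is
SYMMETRIC in the pair — the rank-one regime of Berger–Klosin does not depend on the orientation in which the Selmer space
is read. [folklore] -/
theorem stub_rankLeOne_symm :
    ∀ (p : ℕ) [Fact p.Prime] (k : Type) [Field k] [TopologicalSpace k] [DiscreteTopology k]
      (σ σ' : FramedGaloisRep ℚ k 2) (S : Set (HeightOneSpectrum (NumberField.RingOfIntegers ℚ))),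
      (∀ g, (σ' g).val.det = (σ g).val.det) →
      (GreenbergSelmerRankLeOne p k σ σ' S ↔ GreenbergSelmerRankLeOne p k σ' σ S) := by
  intro p _ k _ _ _ σ σ' S hdet
  have hσ : ∀ g, (σ g).val.det = ((Matrix.GeneralLinearGroup.det (σ g) : kˣ) : k) := fun g =>
    (Matrix.GeneralLinearGroup.val_det_apply (σ g)).symm
  have hσ' : ∀ g, (σ' g).val.det = ((Matrix.GeneralLinearGroup.det (σ g) : kˣ) : k) := fun g =>
    (hdet g).trans (hσ g)
  exact ⟨greenbergSelmerRankLeOne_dual p k σ σ' S _ hσ hσ'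
      (fun A g => -(((Matrix.GeneralLinearGroup.det (σ g))⁻¹ : kˣ) : k) • ((σ' g).val * (A g).adjugate * (σ g).val))
      (fun A g => -(((Matrix.GeneralLinearGroup.det (σ g))⁻¹ : kˣ) : k) • ((σ g).val * (A g).adjugate * (σ' g).val))
      (fun _ _ => rfl) (fun _ _ => rfl),
    greenbergSelmerRankLeOne_dual p k σ' σ S _ hσ' hσ
      (fun A g => -(((Matrix.GeneralLinearGroup.det (σ g))⁻¹ : kˣ) : k) • ((σ g).val * (A g).adjugate * (σ' g).val))
      (fun A g => -(((Matrix.GeneralLinearGroup.det (σ g))⁻¹ : kˣ) : k) • ((σ' g).val * (A g).adjugate * (σ g).val))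
      (fun _ _ => rfl) (fun _ _ => rfl)⟩

end Summit.Langlands.Langlands.Cruxes.ResiduallyYoshidaLifting.SectorKlingenSplit.Fibre

end
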